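import Summits.Ventures.HodgeRepro2.T5BergmanDiscThreshold

/-!
# The integrability threshold of the discrete series: `|a(g)|^{-s} ∈ L¹(SU(1,1))` iff `s > 2`;
# `π_k` is an integrable representation iff `k ≥ 3`

`T5BergmanIntegrableCoeff` / `T5BergmanIntegrableCoeffThree` gave `|a(g)|^{-s} ∈ L¹(SU(1,1), μ)` for
the natural numbers `s ≥ 3`. Here the SHARP statement, for a real exponent `s`:

  `|a(g)|^{-s}` is integrable against a (every) Haar measure of `SU(1,1)`  ⟺  `s > 2`

(`integrable_norm_mat_inv_rpow_iff`). Through the fibration `SU(1,1) = 𝔻 × K` (`T5SU11FibrationHaar`)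
the question is the finiteness of `∫_𝔻 (1 - |z|²)^{s/2 - 2} dA`, settled in `T5BergmanDiscThreshold`:
finite for `s/2 - 2 > -1`, and at `s = 2` infinite; for `s ≤ 2` the function `|a(g)|^{-s} ≥ |a(g)|^{-2}`
(as `|a(g)| ≥ 1`) is then not integrable either.

Read on the lowest-weight matrix coefficient `⟨π_k(g) 1, 1⟩_k = a^{-k} π/(k-1)` of the weight-`k`
Bergman model (`T5BergmanPairing.pairing_act_lowest_eq`):

* `integrable_matrixCoeff_lowest_lowest_iff`: `g ↦ ⟨π_k(g) 1, 1⟩_k ∈ L¹(SU(1,1), μ)` iff `k ≥ 3`;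
* `not_integrable_matrixCoeff_lowest_lowest_two`: the weight-`2` model `π₂⁺` is NOT an integrable
  representation (its lowest-weight coefficient is square-integrable by `T5BergmanSchur` but not
  integrable) — `π₃⁺` (the weight of `N4.3`) is the first integrable member of the holomorphic
  discrete series of `SU(1,1)`, and `|a(g)|^{-k} ∈ L¹` exactly for `k ≥ 3` (`integrable_norm_mat_inv_pow_iff`).

In Rühl's normalisation `k_tree = 2 k_R` this is the classical statement that `(k_R, +)` is integrable
iff `k_R > 1`. Nothing is claimed about (N).

Blind lane: Mathlib + the HodgeRepro2 prefix only; no sorry; axioms ⊆ {propext, Classical.choice,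
Quot.sound}.
-/

namespace Summit.Ventures.HodgeRepro2.T5BergmanIntegrableSharp

open MeasureTheory MeasureTheory.Measure Metric Filter Topology Set
open T5PoincareDensity T5PoincareMeasure T5SU11Unimodular T5SU11Fibration T5SU11FibrationHaar
  T5SU11FibrationCartan T5HaarCircle
open T5BergmanCoefficient T5BergmanPairing T5BergmanFourier T5BergmanParseval T5BergmanActStable
  T5BergmanMatrixCoeff T5BergmanSchur T5BergmanKTypeMatrix T5BergmanIntegrableCoeff
  T5BergmanDiscThreshold
open scoped Real ENNReal NNReal

/-! ### Through the fibration: on `SU(1,1)` -/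

/-- `|a(s(z) · rot u)|^{-s} = (1 - |z|²)^{s/2}` for `z ∈ 𝔻` and real `s`. -/
lemma norm_mat_inv_rpow_fib {z : ℂ} (hz : z ∈ ball (0 : ℂ) 1) (u : Circle) (s : ℝ) :
    ‖mat (fib (z, u)) 0 0‖⁻¹ ^ s = (1 - ‖z‖ ^ 2) ^ (s / 2) := by
  have h := one_sub_norm_orbit_sq (fib (z, u))
  rw [orbit_fib hz u] at h
  have hnn : 0 ≤ ‖mat (fib (z, u)) 0 0‖⁻¹ := by positivity
  rw [h, ← Real.rpow_natCast _ 2, ← Real.rpow_mul hnn]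
  congr 1
  push_cast
  ring

/-- `g ↦ |a(g)|^{-s}` is continuous on `SU(1,1)` (`a ≠ 0`). -/
lemma continuous_norm_mat_inv_rpow (s : ℝ) : Continuous fun g : SU11 => ‖mat g 0 0‖⁻¹ ^ s :=
  (continuous_mat00.norm.inv₀ fun g => (norm_pos_iff.mpr (mat_zero_zero_ne_zero g)).ne').rpow_const
    fun g => Or.inl (inv_ne_zero (norm_pos_iff.mpr (mat_zero_zero_ne_zero g)).ne')

/-- `|⟨π_k(g) 1, 1⟩_k| = (π/(k-1)) · |a(g)|^{-k}` for `k ≥ 2`. -/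
lemma norm_matrixCoeff_lowest_lowest (k : ℕ) (hk : 2 ≤ k) (g : SU11) :
    ‖matrixCoeff k lowest lowest g‖ = (π / ((k : ℝ) - 1)) * ‖mat g 0 0‖⁻¹ ^ k := by
  have hk1 : (1 : ℝ) < k := by exact_mod_cast (by omega : 1 < k)
  have hc : (0 : ℝ) < π / ((k : ℝ) - 1) := div_pos Real.pi_pos (by linarith)
  unfold matrixCoeff
  rw [pairing_act_lowest_eq k hk g, norm_mul, norm_pow, norm_inv, Complex.norm_real,
    Real.norm_eq_abs, abs_of_pos hc]
  ring

variable [MeasurableSpace Circle] [BorelSpace Circle]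

/-- **`|a(g)|^{-s}` is integrable for every real `s > 2`** against every Haar measure of `SU(1,1)`. -/
theorem integrable_norm_mat_inv_rpow (μ : Measure SU11) [IsHaarMeasure μ] {s : ℝ} (hs : 2 < s) :
    Integrable (fun g => ‖mat g 0 0‖⁻¹ ^ s) μ := by
  set F : SU11 → ℝ := fun g => ‖mat g 0 0‖⁻¹ ^ s with hF
  have hcF : Continuous F := continuous_norm_mat_inv_rpow s
  set c := haarScalarFactor (nu haarCircle) μ with hc
  have hc0 : c ≠ 0 := (haarScalarFactor_nu_pos haarCircle μ).ne'
  have hnu : nu haarCircle = c • μ := nu_eq_smul haarCircle μ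
  have hmeas : AEStronglyMeasurable F (nu haarCircle) := hcF.aestronglyMeasurable
  have hint_nu : Integrable F (nu haarCircle) := by
    rw [nu, integrable_map_measure (by rw [← nu]; exact hmeas) measurable_fib.aemeasurable]
    have hae : (fun p : ℂ × Circle => (1 - ‖p.1‖ ^ 2) ^ (s / 2)) =ᵐ[poincare.prod haarCircle]
        (F ∘ fib) := by
      have hnull : (poincare.prod haarCircle) ((ball (0 : ℂ) 1)ᶜ ×ˢ (Set.univ : Set Circle)) = 0 := by
        rw [Measure.prod_prod, poincare_compl_ball, zero_mul]
      rw [Filter.EventuallyEq, ae_iff]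
      apply measure_mono_null _ hnull
      intro p hp
      simp only [Set.mem_setOf_eq] at hp
      refine ⟨?_, Set.mem_univ _⟩
      intro hball
      exact hp (by
        rw [Function.comp_apply, show fib p = fib (p.1, p.2) from rfl, hF]
        simp only
        rw [norm_mat_inv_rpow_fib hball p.2])
    exact ((integrable_rpow_poincare_of_two_lt hs).comp_fst haarCircle).congr hae
  rw [hnu] at hint_nu
  exact (integrable_smul_measure (ENNReal.coe_ne_zero.mpr hc0) ENNReal.coe_ne_top).mp hint_nu

/-- **`|a(g)|^{-2}` is NOT integrable** against any Haar measure of `SU(1,1)`: through the fibration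
it is `∫_𝔻 (1 - |z|²) (1 - |z|²)^{-2} dA = ∞`. -/
theorem not_integrable_norm_mat_inv_sq (μ : Measure SU11) [IsHaarMeasure μ] :
    ¬ Integrable (fun g => ‖mat g 0 0‖⁻¹ ^ 2) μ := by
  intro h
  apply not_integrable_one_sub_poincare
  set F : SU11 → ℝ := fun g => ‖mat g 0 0‖⁻¹ ^ 2 with hF
  have hnu : nu haarCircle = haarScalarFactor (nu haarCircle) μ • μ := nu_eq_smul haarCircle μ
  have hint : Integrable F (nu haarCircle) := by
    rw [hnu]
    exact h.smul_measure ENNReal.coe_ne_top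
  have hint' : Integrable (F ∘ fib) (poincare.prod haarCircle) :=
    (integrable_map_measure hint.aestronglyMeasurable measurable_fib.aemeasurable).mp hint
  have hae : (F ∘ fib) =ᵐ[poincare.prod haarCircle] fun p : ℂ × Circle => 1 - ‖p.1‖ ^ 2 := by
    have hnull : (poincare.prod haarCircle) ((ball (0 : ℂ) 1)ᶜ ×ˢ (Set.univ : Set Circle)) = 0 := by
      rw [Measure.prod_prod, poincare_compl_ball, zero_mul]
    rw [Filter.EventuallyEq, ae_iff]
    apply measure_mono_null _ hnull
    intro p hp
    simp only [Set.mem_setOf_eq] at hp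
    refine ⟨?_, Set.mem_univ _⟩
    intro hball
    exact hp (by
      rw [Function.comp_apply, show fib p = fib (p.1, p.2) from rfl, hF]
      simp only
      have h1 := one_sub_norm_orbit_sq (fib (p.1, p.2))
      rw [orbit_fib hball p.2] at h1
      exact h1.symm)
  have hint'' : Integrable (fun p : ℂ × Circle => 1 - ‖p.1‖ ^ 2) (poincare.prod haarCircle) :=
    hint'.congr hae
  haveI : SFinite poincare := by
    unfold poincare
    infer_instance
  exact (Integrable.comp_fst_iff (IsProbabilityMeasure.ne_zero haarCircle)).mp hint''

/-- **THE INTEGRABILITY THRESHOLD**: for a real exponent `s` and every Haar measure `μ` of `SU(1,1)`,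
`g ↦ |a(g)|^{-s}` is `μ`-integrable iff `s > 2`. -/
theorem integrable_norm_mat_inv_rpow_iff (μ : Measure SU11) [IsHaarMeasure μ] (s : ℝ) :
    Integrable (fun g => ‖mat g 0 0‖⁻¹ ^ s) μ ↔ 2 < s := by
  refine ⟨fun h => ?_, fun h => integrable_norm_mat_inv_rpow μ h⟩
  by_contra hs
  rw [not_lt] at hs
  apply not_integrable_norm_mat_inv_sq μ
  refine h.mono' ?_ (Eventually.of_forall fun g => ?_)
  · exact ((continuous_mat00.norm.inv₀ fun g =>
      (norm_pos_iff.mpr (mat_zero_zero_ne_zero g)).ne').pow 2).aestronglyMeasurable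
  · have h1 := one_le_norm_mat g
    have hpos : 0 < ‖mat g 0 0‖⁻¹ := by
      have : 0 < ‖mat g 0 0‖ := by linarith
      positivity
    have hle : ‖mat g 0 0‖⁻¹ ≤ 1 := inv_le_one_of_one_le₀ h1
    rw [Real.norm_eq_abs, abs_of_nonneg (by positivity), ← Real.rpow_natCast _ 2]
    exact Real.rpow_le_rpow_of_exponent_ge hpos hle (by exact_mod_cast hs)

/-- The natural-number form: `|a(g)|^{-n} ∈ L¹(SU(1,1), μ)` iff `n ≥ 3`. -/
theorem integrable_norm_mat_inv_pow_iff (μ : Measure SU11) [IsHaarMeasure μ] (n : ℕ) :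
    Integrable (fun g => ‖mat g 0 0‖⁻¹ ^ n) μ ↔ 3 ≤ n := by
  have e : (fun g : SU11 => ‖mat g 0 0‖⁻¹ ^ n) = fun g => ‖mat g 0 0‖⁻¹ ^ (n : ℝ) := by
    ext g
    rw [Real.rpow_natCast]
  rw [e, integrable_norm_mat_inv_rpow_iff]
  constructor
  · intro h
    have : 2 < n := by exact_mod_cast h
    omega
  · intro h
    have : 2 < n := by omega
    exact_mod_cast this

/-! ### On the lowest-weight matrix coefficient of the weight-`k` model -/

/-- **`π_k` is an integrable representation iff `k ≥ 3`**, read on the lowest-weight matrix coefficient: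
for `k ≥ 2` and every Haar measure `μ` of `SU(1,1)`, `g ↦ ⟨π_k(g) 1, 1⟩_k` is `μ`-integrable iff
`k ≥ 3`. -/
theorem integrable_matrixCoeff_lowest_lowest_iff (μ : Measure SU11) [IsHaarMeasure μ] (k : ℕ)
    (hk : 2 ≤ k) :
    Integrable (matrixCoeff k lowest lowest) μ ↔ 3 ≤ k := by
  have hk1 : (1 : ℝ) < k := by exact_mod_cast (by omega : 1 < k)
  have hc : (0 : ℝ) < π / ((k : ℝ) - 1) := div_pos Real.pi_pos (by linarith)
  have hint : IntegrableOn (fun w => ‖lowest w‖ ^ 2 * (1 - ‖w‖ ^ 2) ^ (k - 2)) (ball (0 : ℂ) 1) := by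
    refine (integrableOn_monomial k 0).congr_fun (fun w _ => ?_) measurableSet_ball
    simp [lowest]
  have hcont : Continuous (matrixCoeff k lowest lowest) :=
    continuous_matrixCoeff_of_differentiableOn k hk lowest (differentiableOn_const 1) hint lowest
      (differentiableOn_const 1) hint
  have e : (fun g => ‖matrixCoeff k lowest lowest g‖) =
      fun g => (π / ((k : ℝ) - 1)) * ‖mat g 0 0‖⁻¹ ^ k :=
    funext fun g => norm_matrixCoeff_lowest_lowest k hk g
  rw [← integrable_norm_iff hcont.aestronglyMeasurable, e,
    integrable_const_mul_iff (isUnit_iff_ne_zero.mpr hc.ne'), integrable_norm_mat_inv_pow_iff]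

/-- **The weight-`2` model is NOT an integrable representation**: its lowest-weight matrix coefficient
`g ↦ ⟨π_2(g) 1, 1⟩_2 = π a(g)^{-2}` is not integrable against any Haar measure of `SU(1,1)` (it is
square-integrable by `T5BergmanSchur`). -/
theorem not_integrable_matrixCoeff_lowest_lowest_two (μ : Measure SU11) [IsHaarMeasure μ] :
    ¬ Integrable (matrixCoeff 2 lowest lowest) μ := by
  rw [integrable_matrixCoeff_lowest_lowest_iff μ 2 le_rfl]
  omega

/-- **`π_k` is integrable for every `k ≥ 3` and for no `k = 2`** — the two directions of
`integrable_matrixCoeff_lowest_lowest_iff` spelled out for the lowest-weight coefficient. -/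
theorem integrable_matrixCoeff_lowest_lowest_of_three_le (μ : Measure SU11) [IsHaarMeasure μ] (k : ℕ)
    (hk : 3 ≤ k) : Integrable (matrixCoeff k lowest lowest) μ :=
  (integrable_matrixCoeff_lowest_lowest_iff μ k (by omega)).mpr hk

end Summit.Ventures.HodgeRepro2.T5BergmanIntegrableSharp
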